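import Mathlib
import HarnessLib
import HarnessLib.Audit
import Summits.ValiantsHypothesis.Statement
import Literature.Computability.Complexity.Nondeterministic
import Literature.Computability.Complexity.CircuitClasses
import Summits.ValiantsHypothesis.ValiantsHypothesis.Theorems.BoolTransferFpBarDegreeCollapse

/-!
Route: BoolTransfer

DORMANT since 2026-09-04T15:05:16Z (reconciler: no traction for 5 d (last activity item-evidence-added at 2026-08-30T13:52:42Z); parked, not closed — `ledger route dormant route-ValiantsHypothesis-BoolTransfer --off` to reactivate) — unstaffed, not closed; items shared with open routes are served there. `ledger route dormant <id> --off` reactivates.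

# Route BoolTransfer — Boolean nonuniform lower bounds transferred through a GRH-free Bürgisser
theorem

**Thesis X (words).** It suffices to show X = X1 ∧ X2 where (X1, crux BoolGrhFree) Bürgisser's
Boolean collapse holds WITHOUT any Riemann hypothesis: VP_ℂ = VNP_ℂ ⇒ NP ⊆ P/poly; and (X2, support
item BoolNpPpoly) NP ⊄ P/poly. X1 is a theorem under the extended (Dedekind-zeta) Riemann hypothesis
[Burgisser2000TCS Cor. 1.2(1) p. 74, GRH entering only through Thm. 4.1 / Cor. 4.8 = effective
Chebotarev; book numbering Burgisser2000 Thm. 4.5 / Cor. 4.6(1); restated "assuming GRH" in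
arXiv:2406.06217 Thm. 4.10(2), Rem. 4.14], unconditional over finite fields [Burgisser2000TCS Cor.
1.2(2); tree:
Literature.Computability.AlgebraicComplexity.burgisser_collapse_of_VP_eq_VNP_finite_holds] and for
constant-free classes [Koiran2004; Burgisser2009]. X2 is the flagship Boolean conjecture,
definitionally `Literature.Computability.Complexity.NPNotSubsetPPoly` (= stmt-PneNP-0260, target of
PneNP/Circuit): this route is IN SUBSTANCE CONDITIONAL on X2 — it lists X2 as an unstaffed support
item, never works it, and earns unconditional credit for VH only if the PneNP tree delivers X2. Its
own mathematical content is X1 and the three cruxes feeding X1 (characteristic transfer, constant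
elimination, Bürgisser's open F̄_p collapse).

Lean: `(Literature.Computability.AlgebraicComplexity.VP ℂ =
Literature.Computability.AlgebraicComplexity.VNP ℂ →
Literature.Computability.Complexity.Nondeterministic.NP ⊆ Literature.Computability.Complexity.PPoly)
∧ ¬ (Literature.Computability.Complexity.Nondeterministic.NP ⊆
Literature.Computability.Complexity.PPoly)`

## Assembly
Assembly item (restated GRH-free at rev 3, provable now): `Assembly := BoolGrhFree → BoolNpPpoly →
ValiantsHypothesis`. Deciding theorem (glue.lean, certified: planner Sketch.lean rc 0, axioms
propext/Classical.choice/Quot.sound): `closes : BoolGrhFree → BoolCharTransfer → TauConstElim →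
FpBarCollapse → BoolNpPpoly → ConstElimGlue → CharTransferGlue → Assembly → ValiantsHypothesis`, two
lines of logic — `ValiantsHypothesis` unfolds to `VP ℂ ≠ VNP ℂ`; from `VP ℂ = VNP ℂ`, BoolGrhFree
gives `NP ⊆ P/poly`, contradicting BoolNpPpoly. Layer 2 (already filed): ConstElimGlue :
TauConstElim → BoolGrhFree (provable now: PSharpP_subset_PPoly_of_isPBounded_perPoly +
NP_subset_PSharpP_holds, planner SketchConstElim.lean rc 0) and CharTransferGlue : BoolCharTransfer
→ FpBarCollapse → BoolGrhFree (routine, Filter.eventually_atTop + Nat.exists_infinite_primes).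
Repair rev 3 (2026-08-15): the ERH-conditional form of the thesis (old target BoolThesis = ERH ∧ NP
⊄ P/poly, dropped, and the rev-2 ERH assembly, superseded) is Bürgisser's published theorem, kept on
record in Summits/ValiantsHypothesis/ValiantsHypothesis/Theorems/BoolTransferAssembly.lean and
Literature/…/BurgisserBooleanPartsA3Assembly.lean; it is no longer an item, so neither the Dedekind
ERH nor the ValiantBooleanBridge facts sit in this route's cone.

Rationale: WHY THIS LINE. It is the one ValiantsHypothesis route whose engine lives outside algebraic
complexity: a Boolean circuit lower bound (NP ⊄ P/poly, imported, not attacked) plus a TRANSFER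
theorem VP_ℂ = VNP_ℂ ⇒ NP ⊆ P/poly. Bürgisser proved the transfer under GRH [Burgisser2000TCS Cor.
1.2(1); Burgisser2000 Thm. 4.5 / Cor. 4.6(1)]; GRH is used at exactly one step — small primes with
prescribed roots of the minimal polynomials of the circuit's algebraic constants (effective
Chebotarev after Lagarias–Odlyzko / Weinberger, the same step as Koiran1996's
Nullstellensatz-in-AM), tree fact
Literature.Computability.AlgebraicComplexity.rootModPrimeCount_lower_bound_of_GRH. The route's
content is removing that step (crux #2) by one of two roads, both filed with their glue: constant
elimination for the permanent (#4 TauConstElim ⇒ #2 via Burgisser2009's τ(per) ⇒ P^#P ⊆ P/poly,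
GRH-free because constant-free circuits are simulated mod any prime p > n!, as recorded on stmt-1388
after arXiv:2606.25121 §1.3), or characteristic transfer (#3) plus Bürgisser's printed open Problem,
the Boolean collapse over F̄_p (#5). Imports from other areas: analytic number theory only as the
obstruction to be avoided (unconditional least-prime bounds N𝔭 ≤ d_L^16, doi:10.1007/bf01390234,
arXiv:1902.08640, versus (log d_L)² under GRH); arithmetic geometry over finite fields (Lang–Weil /
Chevalley–Warning low-degree points on the variety of admissible constant vectors) as the proposed
tool for #5. What it does that prior routes do not: it makes the GRH-removal and
cross-characteristic questions — hidden hypotheses of route TauConst and of PIT-based lines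
(Literature.Computability.AlgebraicComplexity.kabanets_impagliazzo) — explicit, typed, and wired to
VH by a certified deciding theorem; every crux is reusable outside this route. Honest label:
conditional in substance on NP ⊄ P/poly (support item BoolNpPpoly = stmt-PneNP-0260).

RANKED CRUXES. #2 BoolGrhFree — VP ℂ = VNP ℂ → NP ⊆ P/poly with no Riemann hypothesis (why it might
fail: per_n may be easy only via algebraic constants of degree 2^{n^O(1)} [Burgisser2000TCS §5 (A3)
p. 85]; unconditionally the least good prime has exponentially many bits (N𝔭 ≤ d_L^16) and no
Chebotarev-free constant elimination over ℂ is known — still "assuming GRH" in arXiv:2406.06217 Rem.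
4.14; sources: Burgisser2000TCS, arXiv:2406.06217, doi:10.1007/bf01390234, arXiv:1902.08640,
Koiran1996). #3 BoolCharTransfer — VP ℂ = VNP ℂ → VP = VNP over F̄_p for all large primes p (why it
might fail: the bad primes of a mod-p reduction of a ℚ̄-circuit family depend on n, and "polynomial
size for all n" is not first-order, so no Lefschetz/compactness transfer; printed as an open
Problem, Burgisser2000TCS p. 74; sources: Burgisser2000TCS, arXiv:2406.06217 p. 17,
MalodPortier2008). #4 TauConstElim (shared with route TauConst, stmt-0335) — VP ℂ = VNP ℂ → τ(per_n)
p-bounded over ℤ (why it might fail: "VP = VNP ⇒ VP⁰ = VNP⁰?" is the acknowledged open gap,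
constants 1/2 or algebraic numbers of height 2^{n^O(1)} may be essential; sources: Burgisser2009,
Koiran2004, arXiv:2606.25121 §1.2, arXiv:1307.3863 p. 17). #5 FpBarCollapse — for every prime p, VP
= VNP over F̄_p → NP ⊆ P/poly (why it might fail: the variety of constant vectors making a size-s
skeleton compute HC_n is defined over F_p but all its components may be defined only over F_{p^e}
with e up to 2^{poly(n)}, so descent to F_p costs 2^{poly}; open since 2000, Burgisser2000TCS p. 74;
sources: Burgisser2000TCS Cor. 1.2(2) and p. 74, arXiv:2406.06217 p. 17, tree
Literature.Computability.AlgebraicComplexity.NP_subset_PPoly_of_VP_eq_VNP_finite). Ranking: #2 is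
the node every road must reach and the one where partial progress (average Chebotarev, Linnik-type
bounds in the specific towers, derandomised modular identity tests) is conceivable and reusable; #3
before #4 because #4 is staffed from TauConst; #5 last because it only pays together with #3.

KILL CRITERIA. Every crux is an implication with antecedent VP = VNP, so a refutation of #2, #3 or
#5 is a ¬VH-strength theorem — if one lands, the route closes refuted and the summit flips.
Realistic closes: (i) EXHAUSTED/uninformative if a grounder shows #2 is EQUIVALENT to an
unconditional effective-Chebotarev bound (i.e. GRH-strength input is necessary, not an artefact) and
#3/#5 are grounded as blocked by a necessary-high-degree-constants example over F̄_p; (ii)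
SUPERSEDED in part if route TauConst closes TauConstElim — then #2 follows by ConstElimGlue, the
transfer is a theorem, and what remains here is exactly NP ⊄ P/poly: re-declare as a conditional
bridge on stmt-PneNP-0260 or close superseded; (iii) NP ⊆ P/poly proved anywhere kills the line
outright (drop, not expected). The route must never hold prover time on BoolNpPpoly.

NOT DECOMPOSED YET. Below #2: the three candidate Chebotarev substitutes (average/large-sieve
Chebotarev over the family of constant fields, Linnik-type least-split-prime bounds for the specific
radical/Kummer towers that circuit constants generate, derandomised identity testing for algebraic
numbers mod p) — each becomes a ≤ 3-child glued split only after a grounder says which tower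
actually arises. Below #5: the degree bound "some admissible constant vector of the HC_n-skeleton
variety has coordinates of degree n^O(1) over F_p" → finite-field collapse (in tree) → #5. Below #3:
a uniform height/denominator bound for near-optimal circuits. The #P-version (VP = VNP ⇒ P^#P ⊆
P/poly, Burgisser2000TCS Cor. 1.2) and uniform variants. Nothing below NP ⊄ P/poly, ever (PneNP
tree).

CHEAPEST FALSIFIER. A lookup, already run by the retriage/repair seats and repeated here on the
route text: does print contain either an unconditional characteristic-0 Boolean collapse (would make
#2 KNOWN and the route a restatement) or a model in which polynomial-cost constant elimination
provably fails? Result: Bürgisser's 2024 survey arXiv:2406.06217 (Thm. 4.10(2) p. 17, Rem. 4.14 p.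
18) still states the collapse "assuming the Generalized Riemann Hypothesis … used for the
elimination of potentially helpful complex constants", and Burgisser2000TCS p. 74 prints #3/#5 as an
open Problem — open, not refuted, not known. Next cheapest (refuter, minutes): try to derive from
FpBarCollapse at a FIXED small prime an implausibly strong uniform consequence (e.g. a collapse
contradicting a known unconditional circuit lower bound over F_2); none is expected because the
conclusion NP ⊆ P/poly is consistent with current knowledge.

TWO-LAYER PLAN. Filed: ConstElimGlue : TauConstElim → BoolGrhFree (provable now — planner
SketchConstElim.lean rc 0 from
Literature.Computability.AlgebraicComplexity.PSharpP_subset_PPoly_of_isPBounded_perPoly and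
Literature.Computability.Complexity.NP_subset_PSharpP_holds; a plain prover can paste it) and
CharTransferGlue : BoolCharTransfer → FpBarCollapse → BoolGrhFree (routine: Filter.eventually_atTop,
Nat.exists_infinite_primes; planner Sketch.lean rc 0). Foreseen, not filed: FpBarCollapse ⇐
FpBarDegreeBound → (finite-field collapse, in tree) → FpBarCollapse, k = 2.

SUPPORT. BoolNpPpoly = ¬ (NP ⊆ P/poly), definitionally
Literature.Computability.Complexity.NPNotSubsetPPoly (stmt-PneNP-0260); unstaffed here.
ConstElimGlue, CharTransferGlue as above.

SOURCES. Burgisser2000TCS (= paper:doi-10-1016-s0304-3975-99-00183-8), Burgisser2000,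
arXiv:2406.06217, Koiran1996, Koiran2004, Burgisser2009, MalodPortier2008, doi:10.1007/bf01390234,
arXiv:1902.08640, arXiv:2606.25121, arXiv:1307.3863, KarpLipton1980, Valiant1979.

Novelty: NOVELTY (search-before-claim, retriage + repair seats 2026-08-14/15: `lit search --hybrid "Boolean
part VNP GRH elimination of constants Valiant P/poly"`, `lit vsearch` on the GRH-free statement,
`lit frontier ValiantsHypothesis --since 2015` (30 newest descendants: none on Boolean parts /
constant elimination), `lit bridges ValiantsHypothesis --cross any`; Bürgisser's 2024 survey
arXiv:2406.06217 read at pp. 17–18, the TCS paper (paper:doi-10-1016-s0304-3975-99-00183-8 =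
Burgisser2000TCS) at PDF pp. 3–4, 9, 14–15, arXiv:1902.08640 at p. 3).
Nearest prior art: Bürgisser, "Cook's versus Valiant's hypothesis", TCS 235 (2000) Cor. 1.2(1) p. 74
— the GRH-CONDITIONAL transfer VP_ℂ = VNP_ℂ ⇒ NP ⊆ P/poly (nonuniformly), GRH entering only through
Thm. 4.1 p. 79 / Cor. 4.8 p. 84 (effective Chebotarev after Weinberger, Lagarias–Odlyzko; the same
step as Koiran1996); book numbering Burgisser2000 Thm. 4.5 / Cor. 4.6(1); restated unchanged, still
"assuming the Generalized Riemann Hypothesis", in arXiv:2406.06217 Thm. 4.10(2) p. 17 with Rem. 4.14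
p. 18 (GRH "is used for the elimination of potentially helpful complex constants"). That conditional
bridge (the route's rev ≤ 2 thesis ERH ∧ NP ⊄ P/poly ⇒ VH) is KNOWN and is kept only as a record:
proved in tree as Literature.PNP.erh_and_npNotSubsetPPoly_imp_valiantsHypothesis
(Theorems/BoolTransferAssembly.lean) over the Literature chain that isolates GRH in the single named
fact Literature.Computability.AlgebraicComplexity.rootModPrimeCount_lo  [refs: 10.1007/bf01390234, 2406.06217, 1902.08640, paper:doi-10-1016-s0304-3975-99-00183-8, doi:10.1007/bf01390234, Koiran1996, Burgisser2000, Koiran2004, Burgisser2009, MalodPortier2008]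

Barriers (technique_class: Boolean-transfer, constant-elimination, reduction-mod-p): technique_class: Boolean-transfer, constant-elimination, reduction-mod-p
Catalogued ValiantsHypothesis barriers — none applies to the transfer step, because the route proves
no algebraic lower bound by a measure, distinguisher or obstruction; it imports a Boolean one:
`Literature.Barriers.ValiantsHypothesis.AlgebraicNaturalProofs` (VP-constructible distinguishers,
conditional on succinct hitting sets) — N/A, no distinguisher;
`Literature.Barriers.ValiantsHypothesis.RankMethods` ,
`Literature.Barriers.ValiantsHypothesis.RankLifting` ,
`Literature.Barriers.ValiantsHypothesis.ShiftedPartialsCannotSeparate` ,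
`Literature.Barriers.ValiantsHypothesis.DepthReductionChasm` (rank / flattening / VP-saturated
measures) — N/A, no measure; `Literature.Barriers.ValiantsHypothesis.GCTOccurrenceObstructions` ,
`Literature.Barriers.ValiantsHypothesis.GCTMatrixPowering` ,
`Literature.Barriers.ValiantsHypothesis.GCTUsefulModules` ,
`Literature.Barriers.ValiantsHypothesis.NotViaSaturations` ,
`Literature.Barriers.ValiantsHypothesis.KroneckerPlethysmHardness` (GCT obstruction searches) — N/A;
`Literature.Barriers.ValiantsHypothesis.MonotoneGap` (monotone-to-general transfer) — N/A, nothing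
monotone; `Literature.Barriers.ValiantsHypothesis.TauRealZeros` (real-root counting for τ) — N/A
(the constant-free/τ line is route TauConst, not this one);
`Literature.Barriers.ValiantsHypothesis.NoncommutativeExtensions` (extension-robust, ring-oblivious
formula-size bounds) — N/A, no formula-size argument an

Novelty grade: variant — ROUTE-REVIEW (refuter 2026-08-15, rev 7): KEEP OPEN as conditional bridge; no bad crux. NOVELTY variant: mechanism = Bürgisser's transfer VP_ℂ=VNP_ℂ ⇒ NP ⊆ P/poly, KNOWN under GRH (TCS Cor 1.2(1) p0004 verbatim; still 'under GRH' in 2024 survey p0017 L98/p0018 L93, read here); cruxes = that theorem  (refuter refuter-rreview1-ValiantsHypothesis-BoolTransfe-fcca7755-0, 2026-08-15T18:27:49Z; prior: paper:doi-10-1016-s0304-3975-99-00183-8 (Burgisser2000TCS Cor 1.2, Thm 4.1, p.74 Problem), Burgisser2000 Thm 4.5 / Cor 4.6, arXiv:2406.06217 Thm 4.10(2) p.17, Rem 4.14 p.18, Koiran1996, Burgisser2009 (ECCC TR06-113 Lemma 2.12), arXiv:2606.25121 §1.3, doi:10.1007/bf01390234, arXiv:1902.08640)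

History (route lifecycle, newest last):
- 2026-08-15T16:19:33Z · rev 3: restated BoolNpPpoly (stmt-ValiantsHypothesis-0346), Assembly (stmt-ValiantsHypothesis-0344) — route-repair (glue + cone guardrail, rbadge seat g2): GRH-FREE PIVOT. closes : BoolGrhFree → BoolCharTransfer → TauConstElim → FpBarCollapse → BoolNpPpoly → Con (planner-rbadge-ValiantsHypothesis-BoolTransfer-fcca7755-g2-0)
- 2026-08-15T16:19:33Z · rev 3: dropped BoolThesis — route-repair (glue + cone guardrail, rbadge seat g2): GRH-FREE PIVOT. closes : BoolGrhFree → BoolCharTransfer → TauConstElim → FpBarCollapse → BoolNpPpoly → Con (planner-rbadge-ValiantsHypothesis-BoolTransfer-fcca7755-g2-0)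
- 2026-08-15T16:59:33Z · rev 5: dropped stmt-ValiantsHypothesis-0346, stmt-ValiantsHypothesis-10552 — route-repair fix-up after the 16:21Z gate restart: the rev-3 restate of BoolNpPpoly (stmt-0346 → stmt-10552, inline ¬(NP ⊆ P/poly)) came back inconsistent at re (planner-rbadge-ValiantsHypothesis-BoolTransfer-fcca7755-g2-0)
- 2026-08-15T17:01:12Z · rev 6: dropped stmt-ValiantsHypothesis-0346, stmt-ValiantsHypothesis-10552 — route-repair fix-up after the 16:21Z gate restart: the rev-3 restate of BoolNpPpoly (stmt-0346 → stmt-10552, inline ¬(NP ⊆ P/poly)) came back inconsistent at re (planner-rbadge-ValiantsHypothesis-BoolTransfer-fcca7755-g2-0)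
- 2026-08-23T08:28:33Z · DORMANT — reconciler: no traction for 6 d (last activity statement-grounded at 2026-08-17T07:45:53Z); parked, not closed — `ledger route dormant route-ValiantsHypothesis- (operator:999:2928561)
- 2026-08-26T05:44:54Z · REACTIVATED — reconciler: reactivated — activity statement-closed at 2026-08-26T05:07:59Z after parking at 2026-08-23T08:28:33Z (operator:999:920691)
- 2026-09-04T15:05:16Z · DORMANT — reconciler: no traction for 5 d (last activity item-evidence-added at 2026-08-30T13:52:42Z); parked, not closed — `ledger route dormant route-ValiantsHypothesis (operator:999:2048617)

sub-problem: ValiantsHypothesis · status: dormant · opened planner-ValiantsHypothesis-Survey-0 2026-08-13T06:08:40Z · rev 7 · ledger route-ValiantsHypothesis-BoolTransfer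
GENERATED by the gate from the ledger (D-0016/17). Provers cite these decls: `theorem foo : Summit.ValiantsHypothesis.ValiantsHypothesis.Theses.BoolTransfer.<Decl> := …` in Summits/ValiantsHypothesis/ValiantsHypothesis/Theorems/<Name>.lean.
-/

namespace Summit.ValiantsHypothesis.ValiantsHypothesis.Theses.BoolTransfer

open scoped BigOperators Topology Manifold Classical MeasureTheory ProbabilityTheory Matrix InnerProductSpace ComplexConjugate ContinuousMap
open Filter Set Function TopologicalSpace MeasureTheory

attribute [summit_statement] _root_.ValiantsHypothesis

open Literature.PNP

/-- item stmt-ValiantsHypothesis-0345 · crux · rank 2 · open · by planner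
why it might fail: False iff VP_ℂ=VNP_ℂ ∧ NP⊄P/poly, e.g. per_n easy only via constants of degree 2^{n^O(1)} (TCS (A3) p.85 + Bezout): unconditional least split prime N𝔭 ≤ d_L^16 has exponentially many bits vs (log d_L)² under GRH; no Chebotarev-free constant elimination over ℂ is known (still 'under GRH' in 2024).
sources: Burgisser2000TCS (paper:doi-10-1016-s0304-3975-99-00183-8) Thm 1.1 p.73, Cor 1.2(1) p.74, Thm 4.1 p.79, Cor 4.8 p.84, §5 (A3) p.85 (PDF pp. 3, 4, 9, 14, 15), arXiv:2406.06217 Thm 4.10(2) p.17 and Rem 4.14 p.18 (Bürgisser 2024 survey: the char-0 Boolean collapse is still stated 'assuming the Generalized Riemann Hypothesis', which 'is used for the elimination of potentially helpful complex constants'), doi:10.1007/bf01390234 (Lagarias–Montgomery–Odlyzko 1979, unconditional N𝔭 ≤ d_L^B); arXiv:1902.08640 Thm 1.1 p.3 (B = 16) vs N𝔭 ≪ (log d_L)² under GRH (Lagarias–Odlyzko), Koiran1996 (same GRH step: Nullstellensatz in AM under GRH), tree: Literature.Computability.AlgebraicComplexity.rootModPrimeCount_lower_bound_of_GRH (BurgisserReductionModPrimes.lean:115,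 TCS Cor 4.8) is the only input that USES ERH; every other step of Cor 1.2(1) is proved in tree from algebraicSolution_height_bound (ibid. :93, TCS Thm 4.5), tree: Literature.Computability.AlgebraicComplexity.PPoly_eq_polyAdvice_NP_of_VP_eq_VNP_of_heightBound_of_rootCount (BurgisserBooleanPartsA3Assembly.lean:663) — an ERH-free replacement of the h48 input there would prove this crux outright
Remove ERH from Bürgisser's transfer [Burgisser2000 Thm 4.5]: ERH is used only to find small primes
p with prescribed roots of the minimal polynomials of the algebraic constants (effective Chebotarev
via Koiran1996). Unconditional over finite fields
(Literature.Computability.AlgebraicComplexity.burgisser_collapse_of_VP_eq_VNP_finite). Any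
unconditional substitute (average Chebotarev, Linnik-type bounds for splitting primes in the
specific towers arising, or a derandomised modular identity test) settles it. Boolean face of
tau_const_elim. -/
@[route_item "route-ValiantsHypothesis-BoolTransfer"]
def BoolGrhFree : Prop :=
  Literature.Computability.AlgebraicComplexity.VP ℂ = Literature.Computability.AlgebraicComplexity.VNP ℂ → Literature.Computability.Complexity.Nondeterministic.NP ⊆ Literature.Computability.Complexity.PPoly

/-- item stmt-ValiantsHypothesis-0359 · crux · rank 3 · open · by planner
why it might fail: Reducing a ℚ̄-circuit family for per_n mod p discards finitely many bad primes that DEPEND on n (constants of degree/height up to 2^{n^O(1)}), so no prime need be good for all large n; 'poly size ∀ n' is not first-order, so no Lefschetz/compactness transfer. Printed as an open Problem (TCS p.74).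
sources: Burgisser2000TCS p.74 = PDF p.4 ('Problem. Can similar conclusions be drawn for infinite fields of positive characteristic?'), Thm 4.1 p.79, §5 (A3) p.85 (paper:doi-10-1016-s0304-3975-99-00183-8), arXiv:2406.06217 p.17 (only same-characteristic closure invariance VP^F = VNP^F ⇒ VP^F̄ = VNP^F̄ in the proof of Thm 4.10(2), and Malod's char-p equivalence with VP_nb, Thm 4.8; no cross-characteristic transfer anywhere in the survey), MalodPortier2008 (field-uniform characterisations of VP/VNP; no transfer between characteristics), tree: Literature.Computability.AlgebraicComplexity.burgisser_collapse_of_VP_eq_VNP_finite covers FINITE fields only — F̄_p = AlgebraicClosure (ZMod p) is infinite, so the Boolean payoff needs an F̄_p collapse as well (not in tree, open)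
If per_n has poly-size circuits with complex (wlog Q̄, [Burgisser2000 §4.1]) constants, reduce
modulo primes: the obstruction is that the finite set of bad primes depends on n, so a UNIFORM bound
on denominators/heights of the constants is needed. With an F̄_p analogue of the unconditional
finite-field collapse [Burgisser2000 Cor 4.6(2)] this yields a GRH-free Boolean consequence.
Grounder: check Burgisser2000 §4.1-4.3 for the exact known dependence-on-characteristic statements;
model-theoretic (Lefschetz principle) phrasing fails naively because 'p-bounded' is not first-order. -/
@[route_item "route-ValiantsHypothesis-BoolTransfer"]
def BoolCharTransfer : Prop :=
  Literature.Computability.AlgebraicComplexity.VP ℂ = Literature.Computability.AlgebraicComplexity.VNP ℂ → ∀ᶠ p : ℕ in Filter.atTop, ∀ [Fact p.Prime], Literature.Computability.AlgebraicComplexity.VP (AlgebraicClosure (ZMod p)) = Literature.Computability.AlgebraicComplexity.VNP (AlgebraicClosure (ZMod p))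

/-- item stmt-ValiantsHypothesis-0335 · crux · rank 4 · open · by planner
why it might fail: per_n may be in VP_ℂ only via constants (1/2, algebraic numbers of degree/height 2^{n^O(1)}) while τ(per_n) = n^ω(1): 'VP = VNP ⇒ VP⁰ = VNP⁰?' is the acknowledged open gap (Bürgisser 2009 §1, Koiran 2005 §1, arXiv:2606.25121 §1.2, arXiv:1307.3863 p.17).
sources: arXiv:2606.25121 (Bürgisser 2026) §1.2-1.3 p.3, arXiv:1307.3863 (Mahajan 2013) p.17, Koiran2011 = arXiv:1004.4960 p.5, Thm 1 (= Koiran2004 Thm 4.3, factor 2^p(n)), Burgisser2009 Main Thm 1.2; Burgisser2006 Lemma 2.12 p.8, Burgisser2000 Ch.4 §4.1, Thm 4.5 / Cor 4.6, tree: PSharpP_subset_PPoly_of_isPBounded_perPoly (Literature/Computability/AlgebraicComplexity/SharpPBitsPPoly.lean:351) + NP_subset_PSharpP_holds (Literature/Computability/Complexity/CountingProofs.lean:392) prove TauConstElim → BoolGrhFree (planner Sketch2.lean rc 0, std axioms)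
The honest gap between constant-free lower bounds (VP⁰) and VP_ℂ: eliminate arbitrary complex
constants from polynomial-size circuits for per_n at polynomial cost in the constant-free model over
ℤ. Known pieces: VP_K = VNP_K depends only on the algebraically closed field's characteristic-0
prime part, i.e. reduces to Q̄ [Burgisser2000 §4.1]; algebraic constants can be removed for Boolean
consequences under GRH [Burgisser2000 Thm 4.5; Koiran1996]; Koiran2005 on the cost of computing
integers. Open as stated; also the hidden hypothesis of PIT-based lines
(Literature.Computability.AlgebraicComplexity.kabanets_impagliazzo). -/
@[route_item "route-ValiantsHypothesis-BoolTransfer"]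
def TauConstElim : Prop :=
  Literature.Computability.AlgebraicComplexity.VP ℂ = Literature.Computability.AlgebraicComplexity.VNP ℂ → Literature.Computability.AlgebraicComplexity.IsPBounded (fun n => Literature.Computability.AlgebraicComplexity.constantFreeComplexity (Literature.Computability.AlgebraicComplexity.perPoly (Fin n) ℤ))

/-- item stmt-ValiantsHypothesis-1318 · crux · rank 5 · open · by planner
why it might fail: The variety of constant vectors making a size-s skeleton compute HC_n is defined over F_p but may have all components defined only over F_{p^e}, e up to 2^{poly(n)}: then every admissible constant has exponential degree and descent F̄_p → F_p costs 2^{poly}. Open since 2000 (TCS p.74).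
sources: Burgisser2000TCS p.74 = PDF p.4 (open Problem), Cor 1.2(2) p.74 and its proof p.79 (paper:doi-10-1016-s0304-3975-99-00183-8), arXiv:2406.06217 p.17 (proof of Thm 4.10(2): only VP^F = VNP^F ⇒ VP^F̄ = VNP^F̄ and the char-0 GRH collapse; Thm 4.8 Malod char p, VP_nb), Burgisser2000 §4.1 (field independence for algebraically closed fields of one characteristic), Cor 4.6(2), MalodPortier2008, tree: Literature.Computability.AlgebraicComplexity.NP_subset_PPoly_of_VP_eq_VNP_finite (BurgisserFiniteFields.lean:326), burgisser_collapse_of_VP_eq_VNP_finite_holds (BurgisserFiniteFieldsProofs.lean:201) — Finite k only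
[crux] Bürgisser's Boolean collapse over F̄_p = AlgebraicClosure (ZMod p): for every prime p, VP =
VNP over F̄_p ⇒ NP ⊆ P/poly. Printed as an open Problem (Burgisser2000TCS p.74: 'Can similar
conclusions be drawn for infinite fields of positive characteristic?'); for FINITE fields it is Cor
1.2(2), unconditional and in tree
(Literature.Computability.AlgebraicComplexity.NP_subset_PPoly_of_VP_eq_VNP_finite,
burgisser_collapse_of_VP_eq_VNP_finite_holds). Pays off crux #3: `CharTransferGlue :
BoolCharTransfer → FpBarCollapse → BoolGrhFree` (routine). Mechanism to try: a circuit for HC_n over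
F̄_p has constants in some F_{p^f(n)}; descent to F_p costs poly(f(n)) (coordinates over F_p), so
the crux is a DEGREE bound f(n) = n^O(1) for SOME circuit — Lang–Weil/Chevalley–Warning-type
existence of low-degree points on the variety of admissible constant vectors (defined over F_p,
degree ≤ 2^poly) is the natural tool; Galois-orbit components of huge field of definition are the
failure mode. No heights in char p, so this is the pure 'degree half' of GRH removal. Why it might
fail: the variety of constant vectors making a size-s skeleton compute HC_n is defined over F_p but
may have all componen -/
@[route_item "route-ValiantsHypothesis-BoolTransfer"]
def FpBarCollapse : Prop :=
  ∀ (p : ℕ) [Fact p.Prime], Literature.Computability.AlgebraicComplexity.VP (AlgebraicClosure (ZMod p)) = Literature.Computability.AlgebraicComplexity.VNP (AlgebraicClosure (ZMod p)) → Literature.Computability.Complexity.Nondeterministic.NP ⊆ Literature.Computability.Complexity.PPoly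

/-- item stmt-ValiantsHypothesis-10552 · support · rank 9 · open · by planner
why it might fail: NP ⊆ P/poly contradicts nothing known (best unrestricted circuit lower bounds for NP languages are linear); evidence against it is only Karp–Lipton (PH = Σ₂ᵖ); natural proofs / relativization / algebrization / locality block known techniques.
sources: KarpLipton1980, RazborovRudich1997, CookClay2006, tree: Literature.Computability.Complexity.NPNotSubsetPPoly = stmt-PneNP-0260
[support] NP ⊄ P/poly stated inline: ¬ (Nondeterministic.NP ⊆ PPoly), definitionally (Iff.rfl)
Literature.Computability.Complexity.NPNotSubsetPPoly (posed in Cook's Clay problem description §3;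
its failure collapses PH by Karp–Lipton). The OPEN Boolean hypothesis that Bürgisser's transfer
consumes, registered as this route's own obligation (D-0027: open conjectures are route items, not
cite-only Literature IOUs in the cone); same content as route BoolTransfer's BoolHyp
(stmt-ValiantsHypothesis-0346) and PneNP's CircuitThesis; harder than P ≠ NP and not expected to
receive prover time from this route. [difficulty: open-problem] -/
@[route_item "route-ValiantsHypothesis-BoolTransfer"]
def BoolNpPpoly : Prop :=
  ¬ (Literature.Computability.Complexity.Nondeterministic.NP ⊆ Literature.Computability.Complexity.PPoly)

/-- item stmt-ValiantsHypothesis-1388 · support · rank 9 · closed · proved by Summit.ValiantsHypothesis.ValiantsHypothesis.Theorems.BoolTransfer.constElimGlue_proof (prover) · by planner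
[support] Glue making crux TauConstElim (shared stmt-ValiantsHypothesis-0335) load-bearing for crux
#2 BoolGrhFree: constant elimination for per ⇒ GRH-free Bürgisser transfer (VP ℂ = VNP ℂ → NP ⊆
P/poly). PROVABLE NOW (planner Sketch2.lean rc 0, axioms propext/Classical.choice/Quot.sound), in a
Theorems file importing this route file +
Literature.Computability.AlgebraicComplexity.SharpPBitsPPoly +
Literature.Computability.Complexity.CountingProofs: `theorem constElimGlue :
Summit.ValiantsHypothesis.ValiantsHypothesis.Theses.BoolTransfer.ConstElimGlue := fun hT hV _L hL =>
Literature.Computability.AlgebraicComplexity.PSharpP_subset_PPoly_of_isPBounded_perPoly (hT hV)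
(Literature.Computability.Complexity.NP_subset_PSharpP_holds hL)` [Burgisser2006 Lemma 2.12 p.8
(ECCC TR06-113) = Burgisser2009: τ(PER_n) = n^O(1) ⇒ P^#P ⊆ P/poly, discharged in
SharpPBitsPPoly.lean:351; NP ⊆ P^#P, CountingProofs.lean:392]. Constant-free circuits are simulated
over F_p for any prime p > n! — no Chebotarev step, hence no GRH (arXiv:2606.25121 §1.3 p.3).
Prover: paste and close. -/
@[route_item "route-ValiantsHypothesis-BoolTransfer"]
def ConstElimGlue : Prop :=
  TauConstElim → BoolGrhFree

-- `ConstElimGlue` holds: proved by `Summit.ValiantsHypothesis.ValiantsHypothesis.Theorems.BoolTransfer.constElimGlue_proof` (its module imports this route file, so no `_holds` link can be stated here).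

/-- item stmt-ValiantsHypothesis-1403 · support · rank 9 · closed · proved by Summit.ValiantsHypothesis.ValiantsHypothesis.Theorems.BoolTransfer.charTransferGlue_proof (prover) · by planner
[support] Glue making cruxes #3 BoolCharTransfer and FpBarCollapse (stmt-ValiantsHypothesis-1318)
load-bearing for crux #2 BoolGrhFree: characteristic transfer VP ℂ = VNP ℂ ⇒ VP = VNP over F̄_p for
all large p, plus Bürgisser's F̄_p Boolean collapse, give the GRH-free transfer VP ℂ = VNP ℂ → NP ⊆
P/poly. Routine (planner Sketch.lean rc 0): `by intro hT hC hV; obtain ⟨N, hN⟩ :=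
Filter.eventually_atTop.1 (hT hV); obtain ⟨p, hpN, hp⟩ := Nat.exists_infinite_primes N; haveI : Fact
p.Prime := ⟨hp⟩; exact hC p (hN p hpN)`. Sources: Burgisser2000TCS p.74 (Problem) and Cor 1.2(2);
Mathlib Filter.eventually_atTop, Nat.exists_infinite_primes. Prover: paste and close. -/
@[route_item "route-ValiantsHypothesis-BoolTransfer"]
def CharTransferGlue : Prop :=
  BoolCharTransfer → FpBarCollapse → BoolGrhFree

-- `CharTransferGlue` holds: proved by `Summit.ValiantsHypothesis.ValiantsHypothesis.Theorems.BoolTransfer.charTransferGlue_proof` (its module imports this route file, so no `_holds` link can be stated here).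

/-- item stmt-ValiantsHypothesis-21046 · support · rank 9 · closed · proved by Summit.ValiantsHypothesis.ValiantsHypothesis.Theorems.BoolTransfer.fpBarDegreeCollapse_proof (prover) · by planner
[support] T1 rung of FpBarCollapse (stmt-1318; tenure sweep TABLE row 5, director-valiant g8
16:23:56Z) — DEGREE-BOUNDED 𝔽̄_p collapse: if, for a prime p and some c, EVERY Hamiltonian-cycle
polynomial HC_n has a fan-in-two circuit of size ≤ (n+1)^c whose constants lie in the degree-(n+1)^c
extension 𝔽_{p^{(n+1)^c}} = GaloisField p ((n+1)^c) of 𝔽_p (computing the image of hcPoly (Fin n)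
(ZMod p)), then NP ⊆ P/poly. This is the provable-now part of FpBarCollapse: 'VP = VNP over 𝔽̄_p
with polynomially bounded constant degree ⇒ collapse'. Route: ScalarRestriction (stmt-6380 ✓,
LangWeilTransferScalarRestriction.scalarRestriction_proof: a circuit over GaloisField p r for a
polynomial defined over ZMod p descends to ZMod p at size ≤ A·(r+1)^3·(size+1)) gives HC ∈ VP over
𝔽_p; HC is VNP-complete over 𝔽_p in every characteristic (isVNPComplete_hcPoly_holds), so VP = VNP
over ZMod p; then BurgisserFiniteFields NP_subset_PPoly_of_VP_eq_VNP_finite / ValiantBooleanBridge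
burgisser_collapse_of_VP_eq_VNP_finite_holds. What it leaves open toward 1318: circuits over 𝔽̄_p
whose constants have degree super-polynomial in n (the genuine gap of the 𝔽̄_p → 𝔽_q transfer,
Bürgisser 2000 §4.3). Why it might -/
@[route_item "route-ValiantsHypothesis-BoolTransfer"]
def FpBarDegreeCollapse : Prop :=
  ∀ (p : ℕ) [Fact p.Prime] (c : ℕ), (∀ n : ℕ, ∃ P : Literature.Computability.AlgebraicComplexity.ArithCircuit (GaloisField p ((n + 1) ^ c)) (Fin n × Fin n), P.IsFanInTwo ∧ P.Computes (MvPolynomial.map (algebraMap (ZMod p) (GaloisField p ((n + 1) ^ c))) (Literature.Computability.AlgebraicComplexity.hcPoly (Fin n) (ZMod p))) ∧ P.size ≤ (n + 1) ^ c) → Literature.Computability.Complexity.Nondeterministic.NP ⊆ Literature.Computability.Complexity.PPoly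

/-- `FpBarDegreeCollapse` holds: proved by `Summit.ValiantsHypothesis.ValiantsHypothesis.Theorems.BoolTransfer.fpBarDegreeCollapse_proof`. -/
theorem FpBarDegreeCollapse_holds : FpBarDegreeCollapse := _root_.Summit.ValiantsHypothesis.ValiantsHypothesis.Theorems.BoolTransfer.fpBarDegreeCollapse_proof

-- earlier Assembly (stmt-ValiantsHypothesis-0344, replaced 2026-08-15T16:19:33Z -> stmt-ValiantsHypothesis-10620): retired by None — Literature.NumberTheory.LFunctions.ExtendedRiemannHypothesis ∧ Literature.Computability.Complexity.NPNotSubsetPPoly → Literature.Computability.AlgebraicComplexity.PPoly_eq_polyAdvice_NP_of_VP_eq_VNP ℂ → Literature.Computability.Complexity.Nondeterministic.NP ⊆ Literatu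
/-- item stmt-ValiantsHypothesis-10620 · assembly · rank 1 · closed · proved by Summit.ValiantsHypothesis.ValiantsHypothesis.Theorems.BoolTransfer.assembly_proof (prover) · by planner
[assembly] GRH-free assembly of route BoolTransfer: the GRH-free transfer (crux #2 BoolGrhFree: VP ℂ
= VNP ℂ → NP ⊆ P/poly) and NP ⊄ P/poly (BoolNpPpoly) give Valiant's hypothesis VP ℂ ≠ VNP ℂ — pure
logic, `ValiantsHypothesis` unfolds to `VP ℂ ≠ VNP ℂ`; provable now: `theorem assembly :
…Theses.BoolTransfer.Assembly := fun hG hN hV => hN (hG hV)` (planner Sketch.lean rc 0). The other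
cruxes reach BoolGrhFree through the filed glue items ConstElimGlue (TauConstElim → BoolGrhFree) and
CharTransferGlue (BoolCharTransfer → FpBarCollapse → BoolGrhFree). Supersedes the rev-2 ERH assembly
(ERH ∧ NP⊄P/poly → Bürgisser Cor 4.6(1) → NP ⊆ NP/poly → VH), which is Bürgisser's published theorem
and stays proved on record in
Summits/ValiantsHypothesis/ValiantsHypothesis/Theorems/BoolTransferAssembly.lean
(Literature.PNP.erh_and_npNotSubsetPPoly_imp_valiantsHypothesis). The deciding theorem `closes`
(D-0027) takes all eight items. -/
@[route_item "route-ValiantsHypothesis-BoolTransfer"]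
def Assembly : Prop :=
  BoolGrhFree → BoolNpPpoly → _root_.ValiantsHypothesis

-- `Assembly` holds: proved by `Summit.ValiantsHypothesis.ValiantsHypothesis.Theorems.BoolTransfer.assembly_proof` (its module imports this route file, so no `_holds` link can be stated here).

/-! D-0027 §2.1 — DECIDING THEOREM (planner-authored via `route open/edit --closes-file`; by planner-rbadge-ValiantsHypothesis-BoolTransfer-fcca7755-g2-0 2026-08-15T17:03:15Z):
its hypotheses are this route's items and its conclusion the sub-problem Statement (glue_lint), and it elaborates with this file. -/

@[closes "route-ValiantsHypothesis-BoolTransfer"] theorem closes : BoolGrhFree → BoolCharTransfer → TauConstElim → FpBarCollapse → BoolNpPpoly → ConstElimGlue → CharTransferGlue → Assembly → _root_.ValiantsHypothesis := by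
  intro hGrhFree _ _ _ hNP _ _ _ hV
  exact hNP (hGrhFree hV)

end Summit.ValiantsHypothesis.ValiantsHypothesis.Theses.BoolTransfer
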